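import Summits.AtomisticToContinuum.Crystallization.Theses.PerronTransitivity
import Literature.MathematicalPhysics.StatisticalMechanics.TwoScaleShellSums

/-!
# Crux `TransitiveLocalLimit` (stmt-AtomisticToContinuum-15100), line `registered` (birth skeleton):
# the K*-conditional form of stub 1 `stub_superBoundSparse`

`superBoundSparse_of_noFractionalGain : NoFractionalGain → <signature of stub_superBoundSparse>`:
under the route's copositive crux K* = `PerronTransitivity.NoFractionalGain`
(stmt-AtomisticToContinuum-15098), along every sequence of Lennard-Jones ground states `x N` and
for every `θ > 0` the `θ`-SUPER-bound sites `S = {i : 𝓔ⁱ(x N) ≤ 2E* − θ}` (`E* = ⨅_Q e_LJ(Q)`)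
have density `#S/N → 0`.  This is the derivation the route states for its support item
`FractionalGainGivesTransitivity` (stmt-AtomisticToContinuum-15101): test K* on the ground state
with the weights `c = 1 + t·1_S`.

PROOF.  With `χ = 1_S`, `cᵢcⱼ = 1 + tχᵢ + tχⱼ + t²χᵢχⱼ`, so (symmetry of `V_ij`, `sum_erase_comm`)
`Σᵢ Σ_{j≠i} cᵢcⱼV_ij = 2E(x) + 2t Σ_{i∈S} 𝓔ⁱ + t² Σ_{i∈S} Σ_{j∈S∖i} V_ij ≤ 2E(x) + 2t(2E*−θ)#S + t²C#S`,
where `C = (δ⁻⁶/12 + 1/6)·250·δ⁻⁶` bounds `Σ_{j≠i} |V_ij|` on the `δ`-separated ground states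
(`LennardJonesMinimalDistance_holds`, `sum_inv_pow_six_le`, `abs_lennardJones_le_inv_pow_six`),
while `Σ cᵢ² = N + (2t + t²)#S`.  K* then reads `#S · t · (2θ + 2tE* − tC) ≤ 2(E(x) − N·E*)`; with
`A = C + 2|E*|`, `t = θ/A` the bracket is `≥ θ`, whence `#S ≤ (2A/θ²)(E(N) − N·E*)` and
`#S/N ≤ (2A/θ²)(E(N)/N − E*) → 0` by the PROVED `crysEnergyLimit`.  All [folklore] given K*.
-/

noncomputable section

namespace Summit.AtomisticToContinuum.Crystallization.Theorems.TransitiveLocalLimitBirth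

open Filter Literature.MathematicalPhysics.StatisticalMechanics
open scoped BigOperators

/-- Swapping a double sum over ordered pairs of distinct indices:
`Σᵢ Σ_{j ≠ i} f i j = Σⱼ Σ_{i ≠ j} f i j`. [folklore] -/
theorem sum_erase_comm {N : ℕ} (f : Fin N → Fin N → ℝ) :
    ∑ i, ∑ j ∈ Finset.univ.erase i, f i j = ∑ j, ∑ i ∈ Finset.univ.erase j, f i j := by
  simp_rw [Finset.sum_erase_eq_sub (Finset.mem_univ _)]
  rw [Finset.sum_sub_distrib, Finset.sum_sub_distrib, Finset.sum_comm]

/-- Absolute site sums on separated configurations of `ℝ³`: if all mutual distances in `x` are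
`≥ δ > 0` then `Σ_{j ≠ i} |V_LJ(|xᵢ − xⱼ|)| ≤ (δ⁻⁶/12 + 1/6) · 250 δ⁻⁶`. [folklore] -/
theorem sum_abs_lennardJones_erase_le {N : ℕ} (x : Fin N → EuclideanSpace ℝ (Fin 3)) {δ : ℝ}
    (hδ : 0 < δ) (hsep : ∀ k l, k ≠ l → δ ≤ dist (x k) (x l)) (i : Fin N) :
    ∑ j ∈ Finset.univ.erase i, |lennardJones (dist (x i) (x j))| ≤
      (δ⁻¹ ^ 6 / 12 + 1 / 6) * (250 * δ⁻¹ ^ 6) := by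
  calc ∑ j ∈ Finset.univ.erase i, |lennardJones (dist (x i) (x j))|
      ≤ ∑ j ∈ Finset.univ.erase i, (δ⁻¹ ^ 6 / 12 + 1 / 6) * (dist (x i) (x j))⁻¹ ^ 6 :=
        Finset.sum_le_sum fun j hj =>
          abs_lennardJones_le_inv_pow_six hδ (hsep i j (Finset.ne_of_mem_erase hj).symm)
    _ = (δ⁻¹ ^ 6 / 12 + 1 / 6) * ∑ j ∈ Finset.univ.erase i, (dist (x i) (x j))⁻¹ ^ 6 := by
        rw [Finset.mul_sum]
    _ ≤ (δ⁻¹ ^ 6 / 12 + 1 / 6) * (250 * δ⁻¹ ^ 6) :=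
        mul_le_mul_of_nonneg_left (sum_inv_pow_six_le x hδ hsep i) (by positivity)

/-- **The weight test (finite `N`).** Let `x` be a configuration of `N` points of `ℝ³` whose
absolute site sums are bounded by `C > 0` (`Σ_{j≠i} |V_ij| ≤ C` for all `i`), let `E` be a real
number for which the copositive inequality `2E·Σcᵢ² ≤ Σᵢ Σ_{j≠i} cᵢcⱼV_ij` holds for all weights
`c ≥ 0` on `x`, and let `θ > 0`.  Then the set `S` of `θ`-super-bound sites (`𝓔ⁱ ≤ 2E − θ`)
satisfies `#S ≤ (2(C + 2|E|)/θ²) · (E_LJ(x) − N·E)` (test with `c = 1 + (θ/(C + 2|E|))·1_S`).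
[folklore] -/
theorem card_superBound_le_of_copositive {N : ℕ} (x : Fin N → EuclideanSpace ℝ (Fin 3)) {C E θ : ℝ}
    (hC : 0 < C) (hCi : ∀ i, ∑ j ∈ Finset.univ.erase i, |lennardJones (dist (x i) (x j))| ≤ C)
    (hθ : 0 < θ)
    (hK : ∀ c : Fin N → ℝ, (∀ i, 0 ≤ c i) → 2 * E * ∑ i, c i ^ 2 ≤
      ∑ i, ∑ j ∈ Finset.univ.erase i, c i * c j * lennardJones (dist (x i) (x j))) :
    ((Finset.univ.filter fun i : Fin N => siteEnergy lennardJones x i ≤ 2 * E - θ).card : ℝ) ≤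
      2 * (C + 2 * |E|) / θ ^ 2 * (interactionEnergy lennardJones x - N * E) := by
  set S := Finset.univ.filter fun i : Fin N => siteEnergy lennardJones x i ≤ 2 * E - θ with hS
  set V : Fin N → Fin N → ℝ := fun i j => lennardJones (dist (x i) (x j)) with hV
  set χ : Fin N → ℝ := fun i => if siteEnergy lennardJones x i ≤ 2 * E - θ then 1 else 0 with hχ
  set A : ℝ := C + 2 * |E| with hA
  have hA0 : 0 < A := by positivity
  set t : ℝ := θ / A with ht
  have ht0 : 0 < t := div_pos hθ hA0
  -- the indicator
  have hχ01 : ∀ i, χ i = 0 ∨ χ i = 1 := fun i => by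
    by_cases h : siteEnergy lennardJones x i ≤ 2 * E - θ
    · exact Or.inr (if_pos h)
    · exact Or.inl (if_neg h)
  have hχnn : ∀ i, 0 ≤ χ i := fun i => by rcases hχ01 i with h | h <;> norm_num [h]
  have hχS : ∑ i, χ i = S.card := by
    rw [hS, ← Finset.sum_boole]
  -- the site sums
  have hU : ∀ i, ∑ j ∈ Finset.univ.erase i, V i j = siteEnergy lennardJones x i := fun i => rfl
  -- the weights `c = 1 + t χ`
  set c : Fin N → ℝ := fun i => 1 + t * χ i with hc
  have hc0 : ∀ i, 0 ≤ c i := fun i => by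
    have := hχnn i
    simp only [hc]
    positivity
  have key := hK c hc0
  -- left-hand side: `Σ cᵢ² = N + (2t + t²) #S`
  have hL : ∑ i, c i ^ 2 = N + (2 * t + t ^ 2) * S.card := by
    have h1 : ∀ i, c i ^ 2 = 1 + (2 * t + t ^ 2) * χ i := fun i => by
      rcases hχ01 i with h | h <;> simp only [hc, h] <;> ring
    simp_rw [h1]
    rw [Finset.sum_add_distrib, Finset.sum_const, Finset.card_univ, Fintype.card_fin,
      ← Finset.mul_sum, hχS]
    simp
  -- right-hand side: expansion of `cᵢ cⱼ V_ij`
  have hR : ∑ i, ∑ j ∈ Finset.univ.erase i, c i * c j * V i j =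
      ∑ i, ∑ j ∈ Finset.univ.erase i, V i j + t * ∑ i, χ i * ∑ j ∈ Finset.univ.erase i, V i j +
        t * ∑ i, ∑ j ∈ Finset.univ.erase i, χ j * V i j +
        t ^ 2 * ∑ i, χ i * ∑ j ∈ Finset.univ.erase i, χ j * V i j := by
    have h1 : ∀ i j, c i * c j * V i j =
        V i j + t * (χ i * V i j) + t * (χ j * V i j) + t ^ 2 * (χ i * (χ j * V i j)) := by
      intro i j
      simp only [hc]
      ring
    simp_rw [h1, Finset.sum_add_distrib, Finset.mul_sum]
  -- T1 = 2 E(x)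
  have hT1 : ∑ i, ∑ j ∈ Finset.univ.erase i, V i j = 2 * interactionEnergy lennardJones x := by
    rw [two_mul_interactionEnergy]
    rfl
  -- T3 = T2 by symmetry
  have hT3 : ∑ i, ∑ j ∈ Finset.univ.erase i, χ j * V i j =
      ∑ i, χ i * ∑ j ∈ Finset.univ.erase i, V i j := by
    rw [sum_erase_comm (fun i j => χ j * V i j)]
    refine Finset.sum_congr rfl fun j _ => ?_
    rw [Finset.mul_sum]
    refine Finset.sum_congr rfl fun i _ => ?_
    simp only [hV, dist_comm]
  -- T2 ≤ (2E − θ) #S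
  have hT2 : ∑ i, χ i * ∑ j ∈ Finset.univ.erase i, V i j ≤ (2 * E - θ) * S.card := by
    rw [← hχS, Finset.mul_sum]
    refine Finset.sum_le_sum fun i _ => ?_
    rw [hU i]
    by_cases h : siteEnergy lennardJones x i ≤ 2 * E - θ
    · have : χ i = 1 := if_pos h
      rw [this, one_mul, mul_one]
      exact h
    · have : χ i = 0 := if_neg h
      rw [this, zero_mul, mul_zero]
  -- T4 ≤ C #S
  have hW : ∀ i, ∑ j ∈ Finset.univ.erase i, χ j * V i j ≤ C := fun i => by
    refine le_trans (Finset.sum_le_sum fun j _ => ?_) (hCi i)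
    rcases hχ01 j with h | h
    · rw [h, zero_mul]; exact abs_nonneg _
    · rw [h, one_mul]; exact le_abs_self _
  have hT4 : ∑ i, χ i * ∑ j ∈ Finset.univ.erase i, χ j * V i j ≤ C * S.card := by
    rw [← hχS, Finset.mul_sum]
    refine Finset.sum_le_sum fun i _ => ?_
    rw [mul_comm C]
    exact mul_le_mul_of_nonneg_left (hW i) (hχnn i)
  -- assemble
  have hSnn : (0 : ℝ) ≤ S.card := Nat.cast_nonneg _
  have hmain : (S.card : ℝ) * t * (2 * θ + 2 * t * E - t * C) ≤
      2 * (interactionEnergy lennardJones x - N * E) := by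
    rw [hL, hR, hT1, hT3] at key
    have h2 : t * ∑ i, χ i * ∑ j ∈ Finset.univ.erase i, V i j ≤ t * ((2 * E - θ) * S.card) :=
      mul_le_mul_of_nonneg_left hT2 ht0.le
    have h4 : t ^ 2 * ∑ i, χ i * ∑ j ∈ Finset.univ.erase i, χ j * V i j ≤ t ^ 2 * (C * S.card) :=
      mul_le_mul_of_nonneg_left hT4 (by positivity)
    nlinarith [h2, h4, key]
  have hbr : θ ≤ 2 * θ + 2 * t * E - t * C := by
    have h1 : t * (C - 2 * E) ≤ t * A :=
      mul_le_mul_of_nonneg_left (by rw [hA]; linarith [neg_abs_le E]) ht0.le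
    have h2 : t * A = θ := by rw [ht]; field_simp
    linarith
  have hfin : (S.card : ℝ) * t * θ ≤ 2 * (interactionEnergy lennardJones x - N * E) :=
    le_trans (mul_le_mul_of_nonneg_left hbr (by positivity)) hmain
  have htθ : t * θ = θ ^ 2 / A := by rw [ht]; ring
  have hθA : 0 < θ ^ 2 / A := by positivity
  calc (S.card : ℝ) = (S.card : ℝ) * t * θ / (θ ^ 2 / A) := by
        rw [mul_assoc, htθ, mul_div_assoc, div_self hθA.ne', mul_one]
    _ ≤ 2 * (interactionEnergy lennardJones x - N * E) / (θ ^ 2 / A) :=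
        div_le_div_of_nonneg_right hfin hθA.le
    _ = 2 * (C + 2 * |E|) / θ ^ 2 * (interactionEnergy lennardJones x - N * E) := by
        rw [hA]
        field_simp

/-- **Stub 1 under K*.**  `NoFractionalGain → ` (the registered signature of `stub_superBoundSparse`):
under the copositive crux K* of route `PerronTransitivity`, along every sequence of Lennard-Jones
ground states and for every `θ > 0` the `θ`-super-bound sites have density `→ 0`
(`card_superBound_le_of_copositive` on each ground state with the uniform constant `C` of the
proved minimal distance, then `E(N)/N → E*` = `crysEnergyLimit`).  With the skeleton's sorry-free
`TransitiveLocalLimit_of_parts` and stubs 2–4 this is the support item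
`FractionalGainGivesTransitivity` (stmt-AtomisticToContinuum-15101). [folklore] -/
theorem superBoundSparse_of_noFractionalGain : Summit.AtomisticToContinuum.Crystallization.Theses.PerronTransitivity.NoFractionalGain → ∀ x : (N : ℕ) → (Fin N → EuclideanSpace ℝ (Fin 3)), (∀ N, Literature.MathematicalPhysics.StatisticalMechanics.IsGroundState Literature.MathematicalPhysics.StatisticalMechanics.lennardJones (x N)) → ∀ θ : ℝ, 0 < θ → Filter.Tendsto (fun N : ℕ => ((Finset.univ.filter fun i : Fin N => Literature.MathematicalPhysics.StatisticalMechanics.siteEnergy Literature.MathematicalPhysics.StatisticalMechanics.lennardJones (x N) i ≤ 2 * (⨅ Q : Literature.MathematicalPhysics.StatisticalMechanics.PeriodicConfiguration 3, Q.energyPerParticle Literature.MathematicalPhysics.StatisticalMechanics.lennardJones) - θ).card : ℝ) / N) Filter.atTop (nhds 0) := by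
  intro hK x hx θ hθ
  set E : ℝ := ⨅ Q : PeriodicConfiguration 3, Q.energyPerParticle lennardJones with hE
  obtain ⟨δ, hδ, hδsep⟩ := LennardJonesMinimalDistance_holds
  set C : ℝ := (δ⁻¹ ^ 6 / 12 + 1 / 6) * (250 * δ⁻¹ ^ 6) with hC
  have hC0 : 0 < C := by positivity
  set A : ℝ := C + 2 * |E| with hA
  -- finite-`N` bound on every ground state
  have hcard : ∀ N, ((Finset.univ.filter fun i : Fin N =>
      siteEnergy lennardJones (x N) i ≤ 2 * E - θ).card : ℝ) ≤
        2 * A / θ ^ 2 * (groundStateEnergy lennardJones 3 N - N * E) := fun N => by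
    rw [← (hx N).2]
    refine card_superBound_le_of_copositive (x N) hC0 (fun i => ?_) hθ fun c hc => ?_
    · exact sum_abs_lennardJones_erase_le (x N) hδ
        (fun k l hkl => hδsep N (x N) (hx N) k l hkl) i
    · exact hK N (x N) (hx N).1 c hc
  -- the comparison sequence tends to `0`
  have hlim : Tendsto (fun N : ℕ => 2 * A / θ ^ 2 * (groundStateEnergy lennardJones 3 N / N - E))
      atTop (nhds 0) := by
    have h := (Summit.AtomisticToContinuum.Crystallization.Theorems.ChargedEnergyGapNegative.crysEnergyLimit).sub_const E
    rw [sub_self] at h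
    simpa using h.const_mul (2 * A / θ ^ 2)
  refine squeeze_zero' (Eventually.of_forall fun N => by positivity) ?_ hlim
  filter_upwards [eventually_ge_atTop 1] with N hN
  have hN : (0 : ℝ) < N := by exact_mod_cast hN
  rw [div_le_iff₀ hN]
  have := hcard N
  calc ((Finset.univ.filter fun i : Fin N => siteEnergy lennardJones (x N) i ≤ 2 * E - θ).card : ℝ)
      ≤ 2 * A / θ ^ 2 * (groundStateEnergy lennardJones 3 N - N * E) := this
    _ = 2 * A / θ ^ 2 * (groundStateEnergy lennardJones 3 N / N - E) * N := by
        field_simp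

end Summit.AtomisticToContinuum.Crystallization.Theorems.TransitiveLocalLimitBirth

end
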